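import Mathlib.Analysis.SpecialFunctions.Pow.Real
import Summits.CriticalPhenomena.PercolationContinuityZ3.Theorems.PercNearOneGluingNoHeavyLowerTailAPLParallelFirstOrder
import HarnessLib

/-!
# `NoHeavyLowerTail` (stmt-CriticalPhenomena-4575) — THE WEAK-FACE SHORTCUT LEMMA AT `C = 28/27` (elementary proof) and the
weak-face parallel-composition theorem

Support file (prover prim-ineq-gen-8 gen 59; `--supports stmt-CriticalPhenomena-4575`; memo
run/shared/lean/prim/prim-ineq-gen-8/FINDING-gen59-WEAKFACE.md).  No definitions, no named facts, no sorries.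

Setting (memo gen 58 §0(3),(4) and `…APLParallelFirstOrder`).  On the weak-apex face a three-point piece `(o; u, v)` is described by the
rates `a = P(o↔u)/ε`, `b = P(o↔v)/ε`, `t = P(o↔u↔v)/ε` (`0 ≤ t ≤ a, b`) and `s = P(u↔v) ≤ 1`, with `E = t²/(a·b·s)`.  The apex-free
shortcut of probability `w ∈ [0,1]` maps the rates to `t′ = t + w(a + b − 2t)`, `a′ = a + w(b − t)`, `b′ = b + w(a − t)`,
`s′ = s + w(1 − s)`.  THE WEAK-FACE SHORTCUT LEMMA (`weak_shortcut_le`): if `t² ≤ (28/27)·a·b·s` then `t′² ≤ (28/27)·a′b′s′`.  With the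
Cauchy–Schwarz reduction `union_cs_core` this gives the WEAK-FACE PARALLEL-COMPOSITION THEOREM (`weak_union_le`): the 3-terminal union of
two weak-apex pieces with `E ≤ 28/27` has `E ≤ 28/27`; the constant is sharp (`shortcut_first_order_sharp`).  In gen 58 the lemma rested on
nine exact SOS certificates (0.8–2 MB each); here it receives a one-page proof:
* (`weakface_bernstein_eq`) in the extremal case `t² = C·a·b·s` the defect is `w·[K₀(1−w)² + T·m·w(1−w) + (ab T²/27)·w²]` with `T = a + b − t`,
  `K₀ = a²b²/27 + (a−t)(b−t)(ab − t(a+b)) ≥ 0` (`weakface_K0_nonneg`, the first-order theorem) and `m = ab(a+b)/27 − t(a−t)(b−t)`; so the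
  lemma holds trivially where `m ≥ 0` and otherwise amounts to the discriminant inequality `27·m² ≤ 4ab·K₀` on `{m ≤ 0}`;
* (`weakface_core`, `weakface_disc`) in the variables `E = ab/t²`, `Y = (a−t)(b−t)/t²` one has `27(4abK₀ − 27m²) = t⁶·h(E,Y)` with
  `h = −(E−27)²Y² + 2E(E²+28E−27)Y − E²(E−1)²` CONCAVE in `Y`, the constraint `m ≤ 0` reads `Y ≥ Y₁ = E(E+1)/(E+27)` and realisability
  (`a + b ≥ 2√(ab)`) reads `Y ≤ Y₂ = (√E − 1)²`; at the two ends `h(Y₁) = 4E²(4E−9)(7E²+36E+81)/(E+27)²` and `h(Y₂) = 27(√E−1)³(√E+3)(2√E−3)²`,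
  both `≥ 0` as soon as the interval is non-empty (which forces `E ≥ 9/4`); the tangency of gen 58 is `E = 9/4`, i.e. `P(u↔v) = 3/7`,
  `t/a = 2/3`, where `Y₁ = Y₂` and both end values vanish. [this work]
-/

namespace Summit.CriticalPhenomena.PercolationContinuityZ3.Theorems

namespace APL

/-- **Bernstein form of the weak-face shortcut defect** (homogeneous rates `a, b, t`, `C = 28/27`, extremal `s`: `C·ab·s = t²`, so that
`C·ab·s′ = t² + w(C·ab − t²)`):  `a′b′·(C ab s′) − ab·t′² = w·[K₀(1−w)² + T·m·w(1−w) + (ab·T²/27)·w²]` with `T = a + b − t`,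
`K₀ = a²b²/27 + (a−t)(b−t)(ab − t(a+b))`, `m = ab(a+b)/27 − t(a−t)(b−t)`.  (The middle Bernstein coefficient `K₁ + 2K₀` of gen 58 factorises as
`T·m`.) [this work] -/
theorem weakface_bernstein_eq (a b t w : ℝ) :
    (a + w * (b - t)) * (b + w * (a - t)) * (t ^ 2 + w * (28 / 27 * a * b - t ^ 2)) - a * b * (t + w * (a + b - 2 * t)) ^ 2
      = w * ((a ^ 2 * b ^ 2 / 27 + (a - t) * (b - t) * (a * b - t * (a + b))) * (1 - w) ^ 2
          + (a + b - t) * (a * b * (a + b) / 27 - t * (a - t) * (b - t)) * w * (1 - w)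
          + a * b * (a + b - t) ^ 2 / 27 * w ^ 2) := by
  ring

/-- **First-order coefficient, homogeneous form**: `K₀ = a²b²/27 + (a−t)(b−t)(ab − t(a+b)) ≥ 0` for all real `b` and `0 ≤ t ≤ a`
(`= a⁴·K₀(b/a, t/a)` of `shortcut_first_order`; as a quadratic in `b` its leading coefficient is `(28/27)a² − 2at + t² > 0` and
`4·lead·K₀ = (2·lead·b − t(a−t)(2a−t))² + t²(a−t)(t − 2a/3)²(t + a/3)`). [this work] -/
theorem weakface_K0_nonneg (a b t : ℝ) (ht0 : 0 ≤ t) (hta : t ≤ a) :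
    0 ≤ a ^ 2 * b ^ 2 / 27 + (a - t) * (b - t) * (a * b - t * (a + b)) := by
  have key : 4 * (28 / 27 * a ^ 2 - 2 * a * t + t ^ 2) * (a ^ 2 * b ^ 2 / 27 + (a - t) * (b - t) * (a * b - t * (a + b)))
      = (2 * (28 / 27 * a ^ 2 - 2 * a * t + t ^ 2) * b - t * (a - t) * (2 * a - t)) ^ 2
        + t ^ 2 * (a - t) * (t - 2 * a / 3) ^ 2 * (t + a / 3) := by
    ring
  have hlead : 0 < 28 / 27 * a ^ 2 - 2 * a * t + t ^ 2 ∨ (a = 0 ∧ t = 0) := by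
    by_cases ha : a = 0
    · right; exact ⟨ha, le_antisymm (ha ▸ hta) ht0⟩
    · left; nlinarith [sq_nonneg (a - t), sq_pos_of_ne_zero ha]
  rcases hlead with hlead | ⟨ha, ht⟩
  · have h2 : 0 ≤ t ^ 2 * (a - t) * (t - 2 * a / 3) ^ 2 * (t + a / 3) := by
      have : 0 ≤ a - t := sub_nonneg.2 hta
      have : 0 ≤ t + a / 3 := by linarith
      positivity
    nlinarith [sq_nonneg (2 * (28 / 27 * a ^ 2 - 2 * a * t + t ^ 2) * b - t * (a - t) * (2 * a - t)), key, h2]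
  · subst ha; subst ht; simp

/-- **The core one-dimensional inequality.**  For `x ≥ 1`, `Y ≤ (x−1)²` and `x²(x²+1) ≤ Y(x²+27)` (with `E = x²`: `Y₁ ≤ Y ≤ Y₂`):
`h(E,Y) = −(E−27)²Y² + 2E(E²+28E−27)Y − E²(E−1)² ≥ 0`.  Proof: the interval is non-empty only if `x ≥ 3/2`
(`(x−1)²(x²+27) − x²(x²+1) = −(2x−3)(x²−12x+9)`); `h` is a concave quadratic in `Y`; on the increasing side `h(Y) ≥ h(Y₁)` with
`(E+27)²h(Y₁) = 4E²(4E−9)(7E²+36E+81) ≥ 0`, on the decreasing side `h(Y) ≥ h(Y₂) = 27(x−1)³(x+3)(2x−3)² ≥ 0`. [this work] -/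
theorem weakface_core (x E Y : ℝ) (hE : x ^ 2 = E) (hx : 1 ≤ x) (htop : Y ≤ (x - 1) ^ 2)
    (hm : E * (E + 1) ≤ Y * (E + 27)) :
    0 ≤ -(E - 27) ^ 2 * Y ^ 2 + 2 * E * (E ^ 2 + 28 * E - 27) * Y - E ^ 2 * (E - 1) ^ 2 := by
  subst hE
  have hN : 0 < x ^ 2 + 27 := by positivity
  -- non-emptiness of [Y₁, Y₂] forces x ≥ 3/2
  have hgap : x ^ 2 * (x ^ 2 + 1) ≤ (x - 1) ^ 2 * (x ^ 2 + 27) := le_trans hm (by nlinarith)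
  have hfac : (x - 1) ^ 2 * (x ^ 2 + 27) - x ^ 2 * (x ^ 2 + 1) = -((2 * x - 3) * (x ^ 2 - 12 * x + 9)) := by ring
  have hx32 : 3 / 2 ≤ x := by
    by_contra hlt
    have h1 : 0 < 3 - 2 * x := by linarith [not_le.mp hlt]
    have h2 : x ^ 2 - 12 * x + 9 < 0 := by nlinarith
    nlinarith [mul_pos h1 (neg_pos.2 h2)]
  rcases le_total (2 * (x ^ 2 - 27) ^ 2 * Y) (2 * x ^ 2 * ((x ^ 2) ^ 2 + 28 * x ^ 2 - 27)) with hcase | hcase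
  · -- increasing side: h(Y) ≥ h(Y₁), everything multiplied by (E+27)²
    have key : (x ^ 2 + 27) ^ 2 * (-(x ^ 2 - 27) ^ 2 * Y ^ 2 + 2 * x ^ 2 * ((x ^ 2) ^ 2 + 28 * x ^ 2 - 27) * Y
          - (x ^ 2) ^ 2 * (x ^ 2 - 1) ^ 2)
        = 4 * (x ^ 2) ^ 2 * (4 * x ^ 2 - 9) * (7 * (x ^ 2) ^ 2 + 36 * x ^ 2 + 81)
          + (Y * (x ^ 2 + 27) - x ^ 2 * (x ^ 2 + 1))
            * ((x ^ 2 + 27) * (2 * x ^ 2 * ((x ^ 2) ^ 2 + 28 * x ^ 2 - 27))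
               - (x ^ 2 - 27) ^ 2 * (Y * (x ^ 2 + 27) + x ^ 2 * (x ^ 2 + 1))) := by
      ring
    have h1 : 0 ≤ 4 * (x ^ 2) ^ 2 * (4 * x ^ 2 - 9) * (7 * (x ^ 2) ^ 2 + 36 * x ^ 2 + 81) := by
      have : 0 ≤ 4 * x ^ 2 - 9 := by nlinarith
      positivity
    have h2 : 0 ≤ Y * (x ^ 2 + 27) - x ^ 2 * (x ^ 2 + 1) := by linarith
    have h3 : 0 ≤ (x ^ 2 + 27) * (2 * x ^ 2 * ((x ^ 2) ^ 2 + 28 * x ^ 2 - 27))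
               - (x ^ 2 - 27) ^ 2 * (Y * (x ^ 2 + 27) + x ^ 2 * (x ^ 2 + 1)) := by
      have h4 : (x ^ 2 - 27) ^ 2 * (x ^ 2 * (x ^ 2 + 1)) ≤ (x ^ 2 - 27) ^ 2 * (Y * (x ^ 2 + 27)) :=
        mul_le_mul_of_nonneg_left hm (sq_nonneg _)
      nlinarith [h4, hcase]
    have h5 : 0 ≤ (x ^ 2 + 27) ^ 2 * (-(x ^ 2 - 27) ^ 2 * Y ^ 2 + 2 * x ^ 2 * ((x ^ 2) ^ 2 + 28 * x ^ 2 - 27) * Y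
          - (x ^ 2) ^ 2 * (x ^ 2 - 1) ^ 2) := by
      rw [key]; exact add_nonneg h1 (mul_nonneg h2 h3)
    have hN2 : 0 < (x ^ 2 + 27) ^ 2 := by positivity
    by_contra hneg
    linarith [mul_neg_of_pos_of_neg hN2 (not_le.mp hneg)]
  · -- decreasing side: h(Y) ≥ h(Y₂)
    have key : -(x ^ 2 - 27) ^ 2 * Y ^ 2 + 2 * x ^ 2 * ((x ^ 2) ^ 2 + 28 * x ^ 2 - 27) * Y - (x ^ 2) ^ 2 * (x ^ 2 - 1) ^ 2
        = 27 * (x - 1) ^ 3 * (x + 3) * (2 * x - 3) ^ 2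
          + ((x - 1) ^ 2 - Y) * ((x ^ 2 - 27) ^ 2 * (Y + (x - 1) ^ 2) - 2 * x ^ 2 * ((x ^ 2) ^ 2 + 28 * x ^ 2 - 27)) := by
      ring
    have h1 : 0 ≤ 27 * (x - 1) ^ 3 * (x + 3) * (2 * x - 3) ^ 2 := by
      have : 0 ≤ x - 1 := by linarith
      positivity
    have h2 : 0 ≤ (x - 1) ^ 2 - Y := sub_nonneg.2 htop
    have h3 : 0 ≤ (x ^ 2 - 27) ^ 2 * (Y + (x - 1) ^ 2) - 2 * x ^ 2 * ((x ^ 2) ^ 2 + 28 * x ^ 2 - 27) := by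
      nlinarith [mul_nonneg (sq_nonneg (x ^ 2 - 27)) h2, hcase]
    rw [key]; exact add_nonneg h1 (mul_nonneg h2 h3)

/-- **The discriminant inequality on `{m ≤ 0}`**: for `a, b > 0`, `0 < t ≤ min(a,b)` and `m = ab(a+b)/27 − t(a−t)(b−t) ≤ 0`,
`27·m² ≤ 4ab·K₀`.  (Apply `weakface_core` with `x = √(ab)/t`, `E = ab/t²`, `Y = (a−t)(b−t)/t²`: `x ≥ 1` as `ab ≥ t²`, `Y ≤ (x−1)²` as
`a + b ≥ 2√(ab)`, `E(E+1) ≤ Y(E+27)` as `ab(ab+t²) − (a−t)(b−t)(ab+27t²) = 27t·m ≤ 0`, and `t⁶·h(E,Y) = 27(4abK₀ − 27m²)`.) [this work] -/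
theorem weakface_disc (a b t : ℝ) (ha : 0 < a) (hb : 0 < b) (ht0 : 0 < t) (hta : t ≤ a) (htb : t ≤ b)
    (hm : a * b * (a + b) / 27 - t * (a - t) * (b - t) ≤ 0) :
    27 * (a * b * (a + b) / 27 - t * (a - t) * (b - t)) ^ 2
      ≤ 4 * (a * b) * (a ^ 2 * b ^ 2 / 27 + (a - t) * (b - t) * (a * b - t * (a + b))) := by
  have hab : 0 < a * b := mul_pos ha hb
  have ht2 : t ^ 2 ≤ a * b := by nlinarith [mul_le_mul hta htb ht0.le ha.le]
  set r := Real.sqrt (a * b) with hr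
  have hr0 : 0 ≤ r := Real.sqrt_nonneg _
  have hr2 : r ^ 2 = a * b := Real.sq_sqrt hab.le
  have hrt : t ≤ r := by
    rw [hr, ← Real.sqrt_sq ht0.le]; exact Real.sqrt_le_sqrt ht2
  have hamgm : 2 * r ≤ a + b := by nlinarith [sq_nonneg (a - b), hr2, hr0, ha, hb]
  have htne : t ≠ 0 := ht0.ne'
  -- the core in the variables x = r/t, E = ab/t², Y = (a-t)(b-t)/t²
  have hx : 1 ≤ r / t := by rw [le_div_iff₀ ht0]; linarith
  have hE : (r / t) ^ 2 = a * b / t ^ 2 := by rw [div_pow, hr2]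
  have htop : (a - t) * (b - t) / t ^ 2 ≤ (r / t - 1) ^ 2 := by
    have e1 : (r / t - 1) ^ 2 = (r - t) ^ 2 / t ^ 2 := by field_simp
    rw [e1, div_le_div_iff_of_pos_right (by positivity)]
    nlinarith [hamgm, hr2, ht0]
  have hmm : a * b / t ^ 2 * (a * b / t ^ 2 + 1) ≤ (a - t) * (b - t) / t ^ 2 * (a * b / t ^ 2 + 27) := by
    have e1 : a * b / t ^ 2 * (a * b / t ^ 2 + 1) = a * b * (a * b + t ^ 2) / t ^ 4 := by
      field_simp
    have e2 : (a - t) * (b - t) / t ^ 2 * (a * b / t ^ 2 + 27) = (a - t) * (b - t) * (a * b + 27 * t ^ 2) / t ^ 4 := by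
      field_simp
    rw [e1, e2, div_le_div_iff_of_pos_right (by positivity)]
    have e3 : a * b * (a * b + t ^ 2) - (a - t) * (b - t) * (a * b + 27 * t ^ 2)
        = 27 * t * (a * b * (a + b) / 27 - t * (a - t) * (b - t)) := by ring
    nlinarith [mul_nonpos_iff.2 (Or.inl ⟨(by positivity : (0:ℝ) ≤ 27 * t), hm⟩), e3]
  have core := weakface_core (r / t) (a * b / t ^ 2) ((a - t) * (b - t) / t ^ 2) hE hx htop hmm
  have e4 : (-(a * b / t ^ 2 - 27) ^ 2 * ((a - t) * (b - t) / t ^ 2) ^ 2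
        + 2 * (a * b / t ^ 2) * ((a * b / t ^ 2) ^ 2 + 28 * (a * b / t ^ 2) - 27) * ((a - t) * (b - t) / t ^ 2)
        - (a * b / t ^ 2) ^ 2 * (a * b / t ^ 2 - 1) ^ 2) * t ^ 6
      = 27 * (4 * (a * b) * (a ^ 2 * b ^ 2 / 27 + (a - t) * (b - t) * (a * b - t * (a + b)))
          - 27 * (a * b * (a + b) / 27 - t * (a - t) * (b - t)) ^ 2) := by
    field_simp
    ring
  have h6 : 0 ≤ (-(a * b / t ^ 2 - 27) ^ 2 * ((a - t) * (b - t) / t ^ 2) ^ 2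
        + 2 * (a * b / t ^ 2) * ((a * b / t ^ 2) ^ 2 + 28 * (a * b / t ^ 2) - 27) * ((a - t) * (b - t) / t ^ 2)
        - (a * b / t ^ 2) ^ 2 * (a * b / t ^ 2 - 1) ^ 2) * t ^ 6 := mul_nonneg core (by positivity)
  rw [e4] at h6
  linarith

/-- **The weak-face quadratic form is nonnegative**: for `a, b > 0`, `0 ≤ t ≤ min(a,b)`, `w ∈ [0,1]`:
`K₀(1−w)² + T·m·w(1−w) + (ab·T²/27)·w² ≥ 0` (`T = a + b − t`).  If `m ≥ 0` all three terms are nonnegative; if `m < 0` then `t > 0` and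
`weakface_disc` gives `4·K₀·(abT²/27) ≥ (T·m)²`, so the form is positive semidefinite on the quadrant. [this work] -/
theorem weakface_form_nonneg (a b t w : ℝ) (ha : 0 < a) (hb : 0 < b) (ht0 : 0 ≤ t) (hta : t ≤ a) (htb : t ≤ b)
    (hw0 : 0 ≤ w) (hw1 : w ≤ 1) :
    0 ≤ (a ^ 2 * b ^ 2 / 27 + (a - t) * (b - t) * (a * b - t * (a + b))) * (1 - w) ^ 2
        + (a + b - t) * (a * b * (a + b) / 27 - t * (a - t) * (b - t)) * w * (1 - w)
        + a * b * (a + b - t) ^ 2 / 27 * w ^ 2 := by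
  have hK0 := weakface_K0_nonneg a b t ht0 hta
  have hT : 0 < a + b - t := by linarith
  have hab : 0 < a * b := mul_pos ha hb
  have hD : 0 < a * b * (a + b - t) ^ 2 / 27 := by positivity
  rcases le_or_gt 0 (a * b * (a + b) / 27 - t * (a - t) * (b - t)) with hm | hm
  · have h1 : 0 ≤ (a + b - t) * (a * b * (a + b) / 27 - t * (a - t) * (b - t)) * w * (1 - w) :=
      mul_nonneg (mul_nonneg (mul_nonneg hT.le hm) hw0) (sub_nonneg.2 hw1)
    have h2 : 0 ≤ (a ^ 2 * b ^ 2 / 27 + (a - t) * (b - t) * (a * b - t * (a + b))) * (1 - w) ^ 2 :=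
      mul_nonneg hK0 (sq_nonneg _)
    have h3 : 0 ≤ a * b * (a + b - t) ^ 2 / 27 * w ^ 2 := by positivity
    linarith
  · have htpos : 0 < t := by
      rcases ht0.eq_or_lt with h | h
      · exfalso; subst h; nlinarith [mul_pos hab (add_pos ha hb)]
      · exact h
    have hdisc := weakface_disc a b t ha hb htpos hta htb hm.le
    -- abbreviations A, B, D of the Bernstein coefficients
    set A := a ^ 2 * b ^ 2 / 27 + (a - t) * (b - t) * (a * b - t * (a + b)) with hA
    set M := a * b * (a + b) / 27 - t * (a - t) * (b - t) with hM
    set D := a * b * (a + b - t) ^ 2 / 27 with hDdef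
    have h4 : 0 ≤ 4 * A * D - ((a + b - t) * M) ^ 2 := by
      have e : 4 * A * D - ((a + b - t) * M) ^ 2 = (a + b - t) ^ 2 * (4 * (a * b) * A - 27 * M ^ 2) / 27 := by
        rw [hDdef]; ring
      rw [e]; apply div_nonneg _ (by norm_num)
      exact mul_nonneg (sq_nonneg _) (by linarith)
    have e2 : 4 * D * (A * (1 - w) ^ 2 + (a + b - t) * M * w * (1 - w) + D * w ^ 2)
        = ((a + b - t) * M * (1 - w) + 2 * D * w) ^ 2 + (4 * A * D - ((a + b - t) * M) ^ 2) * (1 - w) ^ 2 := by ring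
    have h5 : 0 ≤ 4 * D * (A * (1 - w) ^ 2 + (a + b - t) * M * w * (1 - w) + D * w ^ 2) := by
      rw [e2]; exact add_nonneg (sq_nonneg _) (mul_nonneg h4 (sq_nonneg _))
    have hD4 : (0:ℝ) < 4 * D := by positivity
    by_contra hneg
    linarith [mul_neg_of_pos_of_neg hD4 (not_le.mp hneg)]

/-- **THE WEAK-FACE SHORTCUT LEMMA at `C = 28/27`.**  For rates `a, b > 0`, `0 ≤ t ≤ min(a, b)` and `s` with `t² ≤ (28/27)·a·b·s`
(i.e. `E = t²/(abs) ≤ 28/27`) and a shortcut probability `w ∈ [0,1]`: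
`(t + w(a+b−2t))² ≤ (28/27)·(a + w(b−t))·(b + w(a−t))·(s + w(1−s))`, i.e. `E′ ≤ 28/27`.  On the weak-apex face an apex-free shortcut never
raises `E` above `28/27`; the constant is sharp (`shortcut_first_order_sharp`).  Replaces the nine SOS certificates of memo gen 58 §0(3)(c′). [this work] -/
theorem weak_shortcut_le (a b t s w : ℝ) (ha : 0 < a) (hb : 0 < b) (ht0 : 0 ≤ t) (hta : t ≤ a) (htb : t ≤ b)
    (hw0 : 0 ≤ w) (hw1 : w ≤ 1) (hE : t ^ 2 ≤ 28 / 27 * a * b * s) :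
    (t + w * (a + b - 2 * t)) ^ 2 ≤ 28 / 27 * (a + w * (b - t)) * (b + w * (a - t)) * (s + w * (1 - s)) := by
  have hab : 0 < a * b := mul_pos ha hb
  have hform := weakface_form_nonneg a b t w ha hb ht0 hta htb hw0 hw1
  have hid := weakface_bernstein_eq a b t w
  have ha' : 0 ≤ a + w * (b - t) := by nlinarith
  have hb' : 0 ≤ b + w * (a - t) := by nlinarith
  have h1 : a * b * (t + w * (a + b - 2 * t)) ^ 2
      ≤ (a + w * (b - t)) * (b + w * (a - t)) * (t ^ 2 + w * (28 / 27 * a * b - t ^ 2)) := by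
    nlinarith [mul_nonneg hw0 hform]
  have h2 : t ^ 2 + w * (28 / 27 * a * b - t ^ 2) ≤ 28 / 27 * a * b * (s + w * (1 - s)) := by
    nlinarith [mul_le_mul_of_nonneg_left hE (sub_nonneg.2 hw1)]
  have h3 : (a + w * (b - t)) * (b + w * (a - t)) * (t ^ 2 + w * (28 / 27 * a * b - t ^ 2))
      ≤ (a + w * (b - t)) * (b + w * (a - t)) * (28 / 27 * a * b * (s + w * (1 - s))) :=
    mul_le_mul_of_nonneg_left h2 (mul_nonneg ha' hb')
  have h4 : a * b * (t + w * (a + b - 2 * t)) ^ 2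
      ≤ a * b * (28 / 27 * (a + w * (b - t)) * (b + w * (a - t)) * (s + w * (1 - s))) := by
    calc _ ≤ _ := h1.trans h3
      _ = _ := by ring
  exact le_of_mul_le_mul_left h4 hab

/-- **THE WEAK-FACE PARALLEL-COMPOSITION THEOREM at `C = 28/27`** (memo gen 58 §0(3)(b)+(c′), now unconditional).  Two weak-apex pieces with
rates `(aᵢ, bᵢ, tᵢ, sᵢ)`, `aᵢ, bᵢ > 0`, `0 ≤ tᵢ ≤ min(aᵢ, bᵢ)`, `0 ≤ sᵢ ≤ 1`, each with `tᵢ² ≤ (28/27)·aᵢbᵢsᵢ` (`E ≤ 28/27`).  Their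
3-terminal union has rates `t = T₁ + T₂`, `a = α₁ + α₂`, `b = β₁ + β₂`, `s = s₁ + s₂ − s₁s₂`, where `(Tᵢ, αᵢ, βᵢ)` are the rates of piece `i`
shortcut by the `u–v` connection probability `s_j` of the other piece (`Tᵢ = tᵢ + s_j(aᵢ+bᵢ−2tᵢ)`, `αᵢ = aᵢ + s_j(bᵢ−tᵢ)`, `βᵢ = bᵢ + s_j(aᵢ−tᵢ)`),
and then `t² ≤ (28/27)·a·b·s`: ON THE WEAK-APEX FACE, PARALLEL COMPOSITION PRESERVES `E ≤ 28/27` (sharp).  Proof: `weak_shortcut_le` twice and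
`union_cs_core`. [this work] -/
theorem weak_union_le (a₁ b₁ t₁ s₁ a₂ b₂ t₂ s₂ : ℝ)
    (ha₁ : 0 < a₁) (hb₁ : 0 < b₁) (ht₁ : 0 ≤ t₁) (ht₁a : t₁ ≤ a₁) (ht₁b : t₁ ≤ b₁) (hs₁ : 0 ≤ s₁) (hs₁1 : s₁ ≤ 1)
    (ha₂ : 0 < a₂) (hb₂ : 0 < b₂) (ht₂ : 0 ≤ t₂) (ht₂a : t₂ ≤ a₂) (ht₂b : t₂ ≤ b₂) (hs₂ : 0 ≤ s₂) (hs₂1 : s₂ ≤ 1)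
    (hE₁ : t₁ ^ 2 ≤ 28 / 27 * a₁ * b₁ * s₁) (hE₂ : t₂ ^ 2 ≤ 28 / 27 * a₂ * b₂ * s₂) :
    ((t₁ + s₂ * (a₁ + b₁ - 2 * t₁)) + (t₂ + s₁ * (a₂ + b₂ - 2 * t₂))) ^ 2
      ≤ 28 / 27 * ((a₁ + s₂ * (b₁ - t₁)) + (a₂ + s₁ * (b₂ - t₂))) * ((b₁ + s₂ * (a₁ - t₁)) + (b₂ + s₁ * (a₂ - t₂)))
          * (s₁ + s₂ - s₁ * s₂) := by
  have h₁ := weak_shortcut_le a₁ b₁ t₁ s₁ s₂ ha₁ hb₁ ht₁ ht₁a ht₁b hs₂ hs₂1 hE₁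
  have h₂ := weak_shortcut_le a₂ b₂ t₂ s₂ s₁ ha₂ hb₂ ht₂ ht₂a ht₂b hs₁ hs₁1 hE₂
  have es₁ : s₁ + s₂ * (1 - s₁) = s₁ + s₂ - s₁ * s₂ := by ring
  have es₂ : s₂ + s₁ * (1 - s₂) = s₁ + s₂ - s₁ * s₂ := by ring
  rw [es₁] at h₁; rw [es₂] at h₂
  have hs : 0 ≤ s₁ + s₂ - s₁ * s₂ := by nlinarith
  have h₁' : (t₁ + s₂ * (a₁ + b₁ - 2 * t₁)) ^ 2 ≤ 28 / 27 * (a₁ + s₂ * (b₁ - t₁)) * (b₁ + s₂ * (a₁ - t₁)) * (s₁ + s₂ - s₁ * s₂) := by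
    simpa [mul_assoc] using h₁
  exact union_cs_core (28 / 27) (s₁ + s₂ - s₁ * s₂) _ _ _ _ _ _ (by norm_num) hs (by nlinarith) (by nlinarith) (by nlinarith) (by nlinarith)
    h₁' (by simpa [mul_assoc] using h₂)

/-! ### Appended (gen 59, second landing): THE FULL-SIMPLEX SHORTCUT THEOREM at `C = 28/27`, elementary

Cells of a piece `(o; u, v)` (total mass `1`): `τ = P(o↔u↔v)`, `A = P(o↔v only)`, `B = P(o↔u only)`, `m = P(u↔v only)`,
`x₀ = 1 − τ − A − B − m = P(all separate)`; so `p = P(o↔u) = τ + B`, `π = P(o↔v) = τ + A`, `κ = τ − pπ`, `E = κ²/(pπm)`.  The apex-free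
shortcut of probability `w` gives `p′ = p + wA`, `π′ = π + wB`, `τ′ = τ + w(A+B)`, `m′ = m + w·x₀`, `κ′ = τ′ − p′π′`.
THEOREM (`shortcut_full_le`): if the piece is Harris (`pπ ≤ τ`) and `κ² ≤ (28/27)·pπm` then `κ′² ≤ (28/27)·p′π′m′`.  Memo gen 58 §0(3)(c‴) proved
this from two exact SOS certificates for the Harris-tight endpoint (`H_red ≥ 0`, 6.5 MB); the proof here is elementary: after the monotone
reduction to the extremal `m` (`C·pπm = κ²`) the defect times `pπ` is a polynomial `PD(τ,A,B,w) = PD₄ + PD₅ + PD₆` (homogeneous parts in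
`(τ,A,B)`); along the ray `σ·(τ,A,B)` the function `PD₄ + σPD₅ + σ²PD₆` is a CONCAVE quadratic (`PD₆ = −pπp′π′w((τ+A+B)² − (1−w)AB) ≤ 0`,
the exact concavity of memo §0(3)(c″)), Harris says `σ* = τ/(pπ) ≥ 1`, at `σ = 0` the value is the weak-face extremal defect `PD₄ ≥ 0`
(`weakface_form_nonneg`), and at `σ = σ*` (the Harris-tight piece = the path `u–o–v`, so that the shortcut produces a TRIANGLE) the value is an
explicit sum of nonnegative terms (`E(triangle) ≤ 1 < 28/27`, cf. `fan_E_le_one`). -/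

/-- **THE FULL-SIMPLEX SHORTCUT THEOREM at `C = 28/27`** (memo gen 58 §0(3)(c‴), now elementary and unconditional).  In the cell variables
`τ, A, B ≥ 0`, `p = τ + B > 0`, `π = τ + A > 0`, Harris `pπ ≤ τ` (which forces `τ + A + B ≤ 1`) and `(τ − pπ)² ≤ (28/27)·pπ·m` (`E ≤ 28/27`), for every
shortcut probability `w ∈ [0,1]`:  `(τ′ − p′π′)² ≤ (28/27)·p′π′m′` with `p′ = p + wA`, `π′ = π + wB`, `τ′ = τ + w(A+B)`, `m′ = m + w(1 − τ − A − B − m)`.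
An apex-free parallel `u–v` connection never pushes a Harris piece above `E = 28/27`. [this work] -/
theorem shortcut_full_le (τ A B m w : ℝ) (hτ : 0 ≤ τ) (hA : 0 ≤ A) (hB : 0 ≤ B)
    (hp : 0 < τ + B) (hπ : 0 < τ + A) (hH : (τ + B) * (τ + A) ≤ τ)
    (hE : (τ - (τ + B) * (τ + A)) ^ 2 ≤ 28 / 27 * ((τ + B) * (τ + A)) * m) (hw0 : 0 ≤ w) (hw1 : w ≤ 1) :
    (τ + w * (A + B) - (τ + B + w * A) * (τ + A + w * B)) ^ 2
      ≤ 28 / 27 * ((τ + B + w * A) * (τ + A + w * B)) * (m + w * (1 - τ - A - B - m)) := by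
  have hN : 0 < (τ + B) * (τ + A) := mul_pos hp hπ
  have hτpos : 0 < τ := lt_of_lt_of_le hN hH
  have hw1' : 0 ≤ 1 - w := sub_nonneg.2 hw1
  have hp1 : 0 ≤ τ + B + w * A := by nlinarith [mul_nonneg hw0 hA]
  have hπ1 : 0 ≤ τ + A + w * B := by nlinarith [mul_nonneg hw0 hB]
  have hN1 : 0 ≤ (τ + B + w * A) * (τ + A + w * B) := mul_nonneg hp1 hπ1
  -- (1) the weak-face endpoint: PD₄ = w · (Bernstein form of `weakface_bernstein_eq` with a = p, b = π, t = τ) ≥ 0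
  have hform := weakface_form_nonneg (τ + B) (τ + A) τ w hp hπ hτ (by linarith) (by linarith) hw0 hw1
  have ePD4 : (τ + B + w * A) * (τ + A + w * B) * (τ ^ 2 + w * (28 / 27 * ((τ + B) * (τ + A)) - τ ^ 2))
        - (τ + B) * (τ + A) * (τ + w * (A + B)) ^ 2
      = w * (((τ + B) ^ 2 * (τ + A) ^ 2 / 27 + (τ + B - τ) * (τ + A - τ) * ((τ + B) * (τ + A) - τ * (τ + B + (τ + A)))) * (1 - w) ^ 2
          + (τ + B + (τ + A) - τ) * ((τ + B) * (τ + A) * (τ + B + (τ + A)) / 27 - τ * (τ + B - τ) * (τ + A - τ)) * w * (1 - w)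
          + (τ + B) * (τ + A) * (τ + B + (τ + A) - τ) ^ 2 / 27 * w ^ 2) := by
    ring
  have hPD4 : 0 ≤ (τ + B + w * A) * (τ + A + w * B) * (τ ^ 2 + w * (28 / 27 * ((τ + B) * (τ + A)) - τ ^ 2))
        - (τ + B) * (τ + A) * (τ + w * (A + B)) ^ 2 := by
    rw [ePD4]; exact mul_nonneg hw0 hform
  -- (2) concavity along the ray: −PD₆ = pπ·p′π′·w·((τ+A+B)² − (1−w)AB) ≥ 0
  have hray : 0 ≤ (τ + A + B) ^ 2 - (1 - w) * A * B := by nlinarith [mul_nonneg hA hB, mul_nonneg hw0 (mul_nonneg hA hB)]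
  have hPD6 : 0 ≤ (τ + B) * (τ + A) * ((τ + B + w * A) * (τ + A + w * B)) * w * ((τ + A + B) ^ 2 - (1 - w) * A * B) :=
    mul_nonneg (mul_nonneg (mul_nonneg hN.le hN1) hw0) hray
  -- (3) the Harris-tight endpoint (triangle): an explicit sum of nonnegative terms
  have hS2 : 0 ≤ (τ + B + (τ + A) - w * τ) ^ 2 := sq_nonneg _
  have hT1 : 0 ≤ 1 / 27 * ((τ + B + w * A) * (τ + A + w * B)) * ((τ + B) * (τ + A)) ^ 2 :=
    mul_nonneg (mul_nonneg (by norm_num) hN1) (sq_nonneg _)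
  have hT2 : 0 ≤ (τ + B) * (τ + A) * ((τ + B) * (τ + A) * (1 - w) - w * τ * (τ + B + (τ + A) - w * τ) / 2) ^ 2 :=
    mul_nonneg hN.le (sq_nonneg _)
  have hT3 : 0 ≤ 3 / 4 * w ^ 2 * ((τ + B) * (τ + A)) * τ ^ 2 * (τ + B + (τ + A) - w * τ) ^ 2 :=
    mul_nonneg (mul_nonneg (mul_nonneg (mul_nonneg (by norm_num) (sq_nonneg _)) hN.le) (sq_nonneg _)) hS2
  have hT4 : 0 ≤ w * (1 - w) * ((τ + B) * (τ + A)) * τ ^ 2 * (τ + B + (τ + A) - w * τ) ^ 2 :=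
    mul_nonneg (mul_nonneg (mul_nonneg (mul_nonneg hw0 hw1') hN.le) (sq_nonneg _)) hS2
  have hT5 : 0 ≤ w * ((τ + B) * (τ + A)) * τ * (A + B) * (τ + B + (τ + A) - w * τ) ^ 2 :=
    mul_nonneg (mul_nonneg (mul_nonneg (mul_nonneg hw0 hN.le) hτ) (add_nonneg hA hB)) hS2
  have hPhi : 0 ≤ w * A * B * (1 / 27 * ((τ + B + w * A) * (τ + A + w * B)) * ((τ + B) * (τ + A)) ^ 2
        + (τ + B) * (τ + A) * ((τ + B) * (τ + A) * (1 - w) - w * τ * (τ + B + (τ + A) - w * τ) / 2) ^ 2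
        + 3 / 4 * w ^ 2 * ((τ + B) * (τ + A)) * τ ^ 2 * (τ + B + (τ + A) - w * τ) ^ 2
        + w * (1 - w) * ((τ + B) * (τ + A)) * τ ^ 2 * (τ + B + (τ + A) - w * τ) ^ 2
        + w * ((τ + B) * (τ + A)) * τ * (A + B) * (τ + B + (τ + A) - w * τ) ^ 2) :=
    mul_nonneg (mul_nonneg (mul_nonneg hw0 hA) hB) (by linarith)
  -- (4) the interpolation identity  τ·pπ·PD = (τ − pπ)·pπ·PD₄ + Φ − PD₆·τ·(τ − pπ)
  have key : τ * ((τ + B) * (τ + A)) *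
        ((τ + B + w * A) * (τ + A + w * B) * (1 - w) * (τ - (τ + B) * (τ + A)) ^ 2
          + 28 / 27 * w * ((τ + B) * (τ + A)) * ((τ + B + w * A) * (τ + A + w * B)) * (1 - τ - A - B)
          - (τ + B) * (τ + A) * (τ + w * (A + B) - (τ + B + w * A) * (τ + A + w * B)) ^ 2)
      = (τ - (τ + B) * (τ + A)) * ((τ + B) * (τ + A)) *
          ((τ + B + w * A) * (τ + A + w * B) * (τ ^ 2 + w * (28 / 27 * ((τ + B) * (τ + A)) - τ ^ 2))
            - (τ + B) * (τ + A) * (τ + w * (A + B)) ^ 2)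
        + w * A * B * (1 / 27 * ((τ + B + w * A) * (τ + A + w * B)) * ((τ + B) * (τ + A)) ^ 2
            + (τ + B) * (τ + A) * ((τ + B) * (τ + A) * (1 - w) - w * τ * (τ + B + (τ + A) - w * τ) / 2) ^ 2
            + 3 / 4 * w ^ 2 * ((τ + B) * (τ + A)) * τ ^ 2 * (τ + B + (τ + A) - w * τ) ^ 2
            + w * (1 - w) * ((τ + B) * (τ + A)) * τ ^ 2 * (τ + B + (τ + A) - w * τ) ^ 2
            + w * ((τ + B) * (τ + A)) * τ * (A + B) * (τ + B + (τ + A) - w * τ) ^ 2)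
        + (τ + B) * (τ + A) * ((τ + B + w * A) * (τ + A + w * B)) * w * ((τ + A + B) ^ 2 - (1 - w) * A * B)
            * τ * (τ - (τ + B) * (τ + A)) := by
    ring
  have hHar : 0 ≤ τ - (τ + B) * (τ + A) := sub_nonneg.2 hH
  have hPDpos : 0 ≤ τ * ((τ + B) * (τ + A)) *
        ((τ + B + w * A) * (τ + A + w * B) * (1 - w) * (τ - (τ + B) * (τ + A)) ^ 2
          + 28 / 27 * w * ((τ + B) * (τ + A)) * ((τ + B + w * A) * (τ + A + w * B)) * (1 - τ - A - B)
          - (τ + B) * (τ + A) * (τ + w * (A + B) - (τ + B + w * A) * (τ + A + w * B)) ^ 2) := by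
    rw [key]
    exact add_nonneg (add_nonneg (mul_nonneg (mul_nonneg hHar hN.le) hPD4) hPhi)
      (mul_nonneg (mul_nonneg hPD6 hτpos.le) hHar)
  have hPD : 0 ≤ (τ + B + w * A) * (τ + A + w * B) * (1 - w) * (τ - (τ + B) * (τ + A)) ^ 2
          + 28 / 27 * w * ((τ + B) * (τ + A)) * ((τ + B + w * A) * (τ + A + w * B)) * (1 - τ - A - B)
          - (τ + B) * (τ + A) * (τ + w * (A + B) - (τ + B + w * A) * (τ + A + w * B)) ^ 2 := by
    have hTN : 0 < τ * ((τ + B) * (τ + A)) := mul_pos hτpos hN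
    by_contra hneg
    linarith [mul_neg_of_pos_of_neg hTN (not_le.mp hneg)]
  -- (5) monotonicity in m:  C·pπ·(C p′π′m′ − κ′²) = C·PD + C·p′π′(1−w)·(C pπ m − κ²)
  have hslack : 0 ≤ (τ + B + w * A) * (τ + A + w * B) * (1 - w) * (28 / 27 * ((τ + B) * (τ + A)) * m - (τ - (τ + B) * (τ + A)) ^ 2) :=
    mul_nonneg (mul_nonneg hN1 hw1') (sub_nonneg.2 hE)
  have key2 : 28 / 27 * ((τ + B) * (τ + A)) *
        (28 / 27 * ((τ + B + w * A) * (τ + A + w * B)) * (m + w * (1 - τ - A - B - m))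
          - (τ + w * (A + B) - (τ + B + w * A) * (τ + A + w * B)) ^ 2)
      = 28 / 27 * ((τ + B + w * A) * (τ + A + w * B) * (1 - w) * (τ - (τ + B) * (τ + A)) ^ 2
          + 28 / 27 * w * ((τ + B) * (τ + A)) * ((τ + B + w * A) * (τ + A + w * B)) * (1 - τ - A - B)
          - (τ + B) * (τ + A) * (τ + w * (A + B) - (τ + B + w * A) * (τ + A + w * B)) ^ 2)
        + 28 / 27 * ((τ + B + w * A) * (τ + A + w * B) * (1 - w)
          * (28 / 27 * ((τ + B) * (τ + A)) * m - (τ - (τ + B) * (τ + A)) ^ 2)) := by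
    ring
  have hfin : 0 ≤ 28 / 27 * ((τ + B) * (τ + A)) *
        (28 / 27 * ((τ + B + w * A) * (τ + A + w * B)) * (m + w * (1 - τ - A - B - m))
          - (τ + w * (A + B) - (τ + B + w * A) * (τ + A + w * B)) ^ 2) := by
    rw [key2]; exact add_nonneg (mul_nonneg (by norm_num) hPD) (mul_nonneg (by norm_num) hslack)
  have hCN : 0 < 28 / 27 * ((τ + B) * (τ + A)) := by positivity
  by_contra hneg
  have hneg' : 28 / 27 * ((τ + B + w * A) * (τ + A + w * B)) * (m + w * (1 - τ - A - B - m))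
      - (τ + w * (A + B) - (τ + B + w * A) * (τ + A + w * B)) ^ 2 < 0 := by linarith [not_le.mp hneg]
  linarith [mul_neg_of_pos_of_neg hCN hneg']

end APL

end Summit.CriticalPhenomena.PercolationContinuityZ3.Theorems
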